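import Mathlib
import Summits.MatrixMultiplication.MatrixMultiplication.Theorems.SoloInformedValTrapezoid

/-!
# SoloInformedValTriforce — triforce-free triples with `N^{2-o(1)}` solutions (the construction)

Pratt [arXiv:2309.03878 (ITCS 2024, LIPIcs 287:89), Def. 4.10] calls `(A, B, C)`, `A B C ⊆ {0,…,n}`,
*triforce-free* if `a+b+c' = a+b'+c = a'+b+c = n` has no solution with `a ≠ a'`, `b ≠ b'`, `c ≠ c'`
(equivalently: the solution set of `a+b+c = n` is a corner-free subset of the triangular grid `Δ_{n+1}`),
writes `Val(△, n)` for the maximum number of solutions of `a+b+c = n` over such triples, proves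
`Val(n) ≤ Val(△, n) ≤ o(n²)` (Prop. 4.11, Prop. 4.13 + the corners theorem) and comments: "a first relaxation
that still seems very stringent is that of a triforce-free triple … for which we know basically nothing."

This file and its sequel `SoloInformedValTriforceAnswer` show `Val(△, N) ≥ N^{2-o(1)}`.  The observation
(soloist, gen 67): with `T := N - C` a triforce-free triple is exactly a corner-free set of the *cylindrical*
form `(A × B) ∩ {a + b ∈ T}`, and Beker's bi-skew corner-free sphere set [arXiv:2402.19169, §2, second
construction and Remark] `{(φ x, φ y) : x, y ∈ [0,m)^d, |x|² = |y|² = r, ⟨x, y⟩ = t}` (`φ` = base-`M` digit map,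
`M ≥ 2m - 1`) IS cylindrical, because on the sphere `⟨x, y⟩ = t ⟺ |x + y|² = 2r + 2t` and `x + y` is read off
`φ x + φ y` digit by digit (no carries).  Contents:

* `TriforceFree` (Def. 4.10, literal) and `TrapezoidFree.triforceFree` (Prop. 4.11: equilateral
  trapezoid-free ⟹ triforce-free);
* digit vectors: `ev` (base-`M` value), `ev_add`, `ev_lt`, `ev_inj`; `box`, `nsq`, `sphere`;
* `rigid` : the four-point identity behind corner-freeness (`|x|²=|x'|²=|y|²=|y'|²`, `|x+y|² = |x+y'|²`,
  `x' + y = x + y'` force `x' = x`);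
* the configuration `setA d m M r` (= `φ(S_r)`), `setC d M r t` (= `2M^d - φ({z : |z|² = 2r+2t})`), target
  `tgt d M = 2 M^d`: `triforceFree_config`, the injection `card_pairs_le` from sphere pairs with `⟨x,y⟩ = t`
  into the solutions, the two pigeonholes `exists_sphere`, `exists_pairs`, and `config_summary` :
  for `1 ≤ m`, `2m ≤ M+1` there are `r, t` with the triple triforce-free and at least
  `(m^d / K)^2 / K` solutions, `K = d (m-1)^2 + 1`; `arith_bound` turns this into `m^{2d} ≤ 4 K^3 · #solutions`.

Standard axioms only; no computation is evaluated by the kernel.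
-/

namespace Summit.MatrixMultiplication.MatrixMultiplication.Theorems.SoloVal

open Finset

/-! ### Definition 4.10 and Proposition 4.11 -/

/-- Pratt's triforce-freeness [arXiv:2309.03878, Def. 4.10] for finite `A, B, C ⊆ ℤ` and target `t`, stated
literally: the system `a+b+c' = a+b'+c = a'+b+c = t` has no solution with `a ≠ a'`, `b ≠ b'`, `c ≠ c'`. -/
def TriforceFree (A B C : Finset ℤ) (t : ℤ) : Prop :=
  ∀ a ∈ A, ∀ a' ∈ A, ∀ b ∈ B, ∀ b' ∈ B, ∀ c ∈ C, ∀ c' ∈ C,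
    a + b + c' = t → a + b' + c = t → a' + b + c = t → (a = a' ∨ b = b' ∨ c = c')

/-- In a triforce the three coordinate shifts agree (so the three inequalities of Def. 4.10 are one). -/
theorem triforce_shifts {a a' b b' c c' t : ℤ} (h1 : a + b + c' = t) (h2 : a + b' + c = t)
    (h3 : a' + b + c = t) : a' - a = b' - b ∧ b' - b = c' - c := by
  constructor <;> linarith

/-- [Pratt, Prop. 4.11]: an equilateral trapezoid-free triple is triforce-free (already its first system
suffices). -/
theorem TrapezoidFree.triforceFree {A B C : Finset ℤ} {t : ℤ} (h : TrapezoidFree A B C t) :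
    TriforceFree A B C t := by
  intro a ha a' ha' b hb b' hb' c hc c' hc' h1 h2 h3
  refine Or.inr (Or.inr (h.1 a ha b hb c hc c' hc' ?_ ?_ ?_ ?_))
  · rw [show t - a - c = b' by linarith]; exact hb'
  · rw [show t - b - c = a' by linarith]; exact ha'
  · rw [show t - a - c' = b by linarith]; exact hb
  · rw [show t - b - c' = a by linarith]; exact ha

/-! ### Digit vectors -/

/-- Base-`M` value of a digit vector `x : Fin d → ℕ` (least significant digit first). -/
def ev (M : ℕ) : (d : ℕ) → (Fin d → ℕ) → ℕ
  | 0, _ => 0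
  | d + 1, x => x 0 + M * ev M d (fun j => x j.succ)

/-- `ev` is additive (no carries are involved: it is a linear form). -/
theorem ev_add (M : ℕ) : ∀ (d : ℕ) (x y : Fin d → ℕ), ev M d (x + y) = ev M d x + ev M d y
  | 0, _, _ => rfl
  | d + 1, x, y => by
      have ih := ev_add M d (fun j => x j.succ) (fun j => y j.succ)
      have hxy : (fun j : Fin d => (x + y) j.succ) = (fun j => x j.succ) + (fun j => y j.succ) := rfl
      simp only [ev]
      rw [hxy, ih, Pi.add_apply]
      ring

/-- Digits `< M` give value `< M^d`. -/
theorem ev_lt (M : ℕ) : ∀ (d : ℕ) (x : Fin d → ℕ), (∀ j, x j < M) → ev M d x < M ^ d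
  | 0, _, _ => by simp [ev]
  | d + 1, x, hx => by
      have ih := ev_lt M d (fun j => x j.succ) (fun j => hx j.succ)
      have h0 := hx 0
      have hmul := Nat.mul_le_mul_left M ih
      simp only [ev, pow_succ]
      rw [Nat.mul_succ] at hmul
      nlinarith

/-- Digit vectors with digits `< M` are determined by their value (uniqueness of base-`M` digits). -/
theorem ev_inj (M : ℕ) : ∀ (d : ℕ) (x y : Fin d → ℕ), (∀ j, x j < M) → (∀ j, y j < M) →
    ev M d x = ev M d y → x = y
  | 0, x, y, _, _, _ => funext fun j => Fin.elim0 j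
  | d + 1, x, y, hx, hy, h => by
      simp only [ev] at h
      have hM : 0 < M := lt_of_le_of_lt (Nat.zero_le _) (hx 0)
      have h0 : x 0 = y 0 := by
        have hmod := congrArg (· % M) h
        simp only [Nat.add_mul_mod_self_left, Nat.mod_eq_of_lt (hx 0), Nat.mod_eq_of_lt (hy 0)] at hmod
        exact hmod
      have htail : ev M d (fun j => x j.succ) = ev M d (fun j => y j.succ) := by
        apply Nat.eq_of_mul_eq_mul_left hM
        omega
      have ih := ev_inj M d _ _ (fun j => hx j.succ) (fun j => hy j.succ) htail
      funext j
      refine Fin.cases h0 (fun i => ?_) j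
      exact congrFun ih i

/-- The digit box `[0, m)^d`. -/
def box (d m : ℕ) : Finset (Fin d → ℕ) := Fintype.piFinset fun _ => range m

/-- Membership in the box. -/
theorem mem_box {d m : ℕ} {x : Fin d → ℕ} : x ∈ box d m ↔ ∀ j, x j < m := by
  simp [box, Fintype.mem_piFinset]

/-- The box has `m^d` points. -/
theorem card_box (d m : ℕ) : #(box d m) = m ^ d := by
  rw [box, Fintype.card_piFinset_const, card_range]

/-- Squared Euclidean norm of a digit vector. -/
def nsq {d : ℕ} (x : Fin d → ℕ) : ℕ := ∑ j, x j ^ 2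

/-- The sphere `S_r = {x ∈ [0,m)^d : |x|² = r}`. -/
def sphere (d m r : ℕ) : Finset (Fin d → ℕ) := (box d m).filter (fun x => nsq x = r)

/-- Norm bound on the box. -/
theorem nsq_le {d m : ℕ} {x : Fin d → ℕ} (hx : ∀ j, x j < m) : nsq x ≤ d * (m - 1) ^ 2 := by
  unfold nsq
  calc ∑ j, x j ^ 2 ≤ ∑ _j : Fin d, (m - 1) ^ 2 :=
        sum_le_sum fun j _ => Nat.pow_le_pow_left (by have := hx j; omega) 2
    _ = d * (m - 1) ^ 2 := by simp

/-- Inner-product bound on the box. -/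
theorem ip_le {d m : ℕ} {x y : Fin d → ℕ} (hx : ∀ j, x j < m) (hy : ∀ j, y j < m) :
    ∑ j, x j * y j ≤ d * (m - 1) ^ 2 := by
  calc ∑ j, x j * y j ≤ ∑ _j : Fin d, (m - 1) ^ 2 :=
        sum_le_sum fun j _ => by
          rw [sq]; exact Nat.mul_le_mul (by have := hx j; omega) (by have := hy j; omega)
    _ = d * (m - 1) ^ 2 := by simp

/-- **Rigidity.**  If `|x|² = |x'|² = |y|² = |y'|²`, `|x+y|² = |x+y'|²` and `x' + y = x + y'` then `x' = x`
(the computation `Σ (x'-x)² = |x'|² - |x|² - 2⟨x,y'⟩ + 2⟨x,y⟩ = 0` behind Beker's corner-freeness). -/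
theorem rigid {d : ℕ} {x x' y y' : Fin d → ℕ} {r R : ℕ}
    (hx : nsq x = r) (hx' : nsq x' = r) (hy : nsq y = r) (hy' : nsq y' = r)
    (hxy : nsq (x + y) = R) (hxy' : nsq (x + y') = R) (hP : ∀ j, x' j + y j = x j + y' j) :
    x' = x := by
  unfold nsq at hx hx' hy hy' hxy hxy'
  simp only [Pi.add_apply] at hxy hxy'
  have hx_z : ∑ j, (x j : ℤ) ^ 2 = r := by exact_mod_cast hx
  have hx'_z : ∑ j, (x' j : ℤ) ^ 2 = r := by exact_mod_cast hx'
  have hy_z : ∑ j, (y j : ℤ) ^ 2 = r := by exact_mod_cast hy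
  have hy'_z : ∑ j, (y' j : ℤ) ^ 2 = r := by exact_mod_cast hy'
  have hxy_z : ∑ j, ((x j : ℤ) + y j) ^ 2 = R := by exact_mod_cast hxy
  have hxy'_z : ∑ j, ((x j : ℤ) + y' j) ^ 2 = R := by exact_mod_cast hxy'
  have e : ∀ j, ((x' j : ℤ) - x j) ^ 2 =
      ((x' j : ℤ) ^ 2 - (x j : ℤ) ^ 2) - (((x j : ℤ) + y' j) ^ 2 - (x j : ℤ) ^ 2 - (y' j : ℤ) ^ 2)
        + (((x j : ℤ) + y j) ^ 2 - (x j : ℤ) ^ 2 - (y j : ℤ) ^ 2) := by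
    intro j
    have hj : (x' j : ℤ) = x j + y' j - y j := by have := hP j; omega
    rw [hj]; ring
  have key : ∑ j, ((x' j : ℤ) - x j) ^ 2 = 0 := by
    rw [sum_congr rfl (fun j _ => e j)]
    simp only [sum_add_distrib, sum_sub_distrib]
    rw [hx'_z, hx_z, hxy'_z, hy'_z, hxy_z, hy_z]
    ring
  have hzero := (sum_eq_zero_iff_of_nonneg (fun j _ => sq_nonneg ((x' j : ℤ) - x j))).1 key
  funext j
  have h2 : ((x' j : ℤ) - x j) ^ 2 = 0 := hzero j (mem_univ j)
  have h3 : (x' j : ℤ) - x j = 0 := pow_eq_zero_iff (two_ne_zero) |>.1 h2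
  omega

/-! ### The configuration -/

section Config

variable (d m M r t : ℕ)

/-- `A = B = φ(S_r)`: base-`M` values of the sphere of radius `√r` in `[0,m)^d`. -/
noncomputable def setA : Finset ℤ := (sphere d m r).image (fun x => (ev M d x : ℤ))

/-- The target `2 M^d`. -/
def tgt : ℕ := 2 * M ^ d

/-- `C = 2M^d - φ({z ∈ [0,M)^d : |z|² = 2r + 2t})`. -/
noncomputable def setC : Finset ℤ :=
  (sphere d M (2 * r + 2 * t)).image (fun z => (tgt d M : ℤ) - ev M d z)

/-- Sphere pairs with inner product `t` (Beker's set `A_{r,t}` in coordinates). -/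
def pairs : Finset ((Fin d → ℕ) × (Fin d → ℕ)) :=
  (sphere d m r ×ˢ sphere d m r).filter (fun p => ∑ j, p.1 j * p.2 j = t)

/-- Elements of `A` lie in `[0, M^d)` (for `m ≤ M`). -/
theorem setA_bounds (hmM : m ≤ M) {a : ℤ} (ha : a ∈ setA d m M r) : 0 ≤ a ∧ a < (M : ℤ) ^ d := by
  simp only [setA, mem_image] at ha
  obtain ⟨x, hx, rfl⟩ := ha
  simp only [sphere, mem_filter, mem_box] at hx
  have := ev_lt M d x (fun j => lt_of_lt_of_le (hx.1 j) hmM)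
  exact ⟨by positivity, by exact_mod_cast this⟩

/-- Elements of `C` lie in `(M^d, 2M^d]`. -/
theorem setC_bounds {c : ℤ} (hc : c ∈ setC d M r t) : (M : ℤ) ^ d < c ∧ c ≤ 2 * (M : ℤ) ^ d := by
  simp only [setC, mem_image] at hc
  obtain ⟨z, hz, rfl⟩ := hc
  simp only [sphere, mem_filter, mem_box] at hz
  have h' : (ev M d z : ℤ) < (M : ℤ) ^ d := by exact_mod_cast ev_lt M d z hz.1
  have h0 : (0 : ℤ) ≤ (ev M d z : ℤ) := by positivity
  simp only [tgt]
  push_cast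
  constructor
  · linarith
  · linarith

/-- **The configuration is triforce-free** (for `2m ≤ M + 1`, i.e. no carries). -/
theorem triforceFree_config (hmM : 2 * m ≤ M + 1) :
    TriforceFree (setA d m M r) (setA d m M r) (setC d M r t) (tgt d M) := by
  intro a ha a' ha' b hb b' hb' c hc c' hc' h1 h2 h3
  simp only [setA, setC, mem_image] at ha ha' hb hb' hc hc'
  obtain ⟨x, hx, rfl⟩ := ha
  obtain ⟨x', hx', rfl⟩ := ha'
  obtain ⟨y, hy, rfl⟩ := hb
  obtain ⟨y', hy', rfl⟩ := hb'
  obtain ⟨z, hz, rfl⟩ := hc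
  obtain ⟨z', hz', rfl⟩ := hc'
  simp only [sphere, mem_filter, mem_box] at hx hx' hy hy' hz hz'
  have bxy : ∀ j, (x + y) j < M := fun j => by
    simp only [Pi.add_apply]; have := hx.1 j; have := hy.1 j; omega
  have bxy' : ∀ j, (x + y') j < M := fun j => by
    simp only [Pi.add_apply]; have := hx.1 j; have := hy'.1 j; omega
  have bx'y : ∀ j, (x' + y) j < M := fun j => by
    simp only [Pi.add_apply]; have := hx'.1 j; have := hy.1 j; omega
  have v1 : x + y = z' := by
    refine ev_inj M d _ _ bxy hz'.1 ?_
    rw [ev_add]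
    have : (ev M d x : ℤ) + ev M d y = ev M d z' := by linarith
    exact_mod_cast this
  have v2 : x + y' = z := by
    refine ev_inj M d _ _ bxy' hz.1 ?_
    rw [ev_add]
    have : (ev M d x : ℤ) + ev M d y' = ev M d z := by linarith
    exact_mod_cast this
  have v3 : x' + y = z := by
    refine ev_inj M d _ _ bx'y hz.1 ?_
    rw [ev_add]
    have : (ev M d x' : ℤ) + ev M d y = ev M d z := by linarith
    exact_mod_cast this
  have hP : ∀ j, x' j + y j = x j + y' j := fun j => by
    have e3 := congrFun v3 j
    have e2 := congrFun v2 j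
    simp only [Pi.add_apply] at e3 e2
    omega
  have n1 : nsq (x + y) = 2 * r + 2 * t := by rw [v1]; exact hz'.2
  have n2 : nsq (x + y') = 2 * r + 2 * t := by rw [v2]; exact hz.2
  have hxx : x' = x := rigid hx.2 hx'.2 hy.2 hy'.2 n1 n2 hP
  left
  rw [hxx]

/-- **Counting.**  `(x, y) ↦ (φ x, φ y, 2M^d - φ x - φ y)` injects the sphere pairs with `⟨x,y⟩ = t` into the
solutions of `a + b + c = 2M^d` in `A × A × C`. -/
theorem card_pairs_le (hm : 1 ≤ m) (hmM : 2 * m ≤ M + 1) :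
    #(pairs d m r t) ≤ #(solutions (setA d m M r) (setA d m M r) (setC d M r t) (tgt d M)) := by
  have hmM' : m ≤ M := by omega
  refine card_le_card_of_injOn
    (fun p => ((ev M d p.1 : ℤ), (ev M d p.2 : ℤ), (tgt d M : ℤ) - ev M d p.1 - ev M d p.2)) ?_ ?_
  · intro p hp
    have hp' : p ∈ pairs d m r t := hp
    simp only [pairs, mem_filter, mem_product, sphere, mem_box] at hp'
    obtain ⟨⟨⟨hx1, hx2⟩, ⟨hy1, hy2⟩⟩, hip⟩ := hp'
    have hmem : ((ev M d p.1 : ℤ), (ev M d p.2 : ℤ), (tgt d M : ℤ) - ev M d p.1 - ev M d p.2) ∈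
        solutions (setA d m M r) (setA d m M r) (setC d M r t) (tgt d M) := by
      simp only [solutions, mem_filter, mem_product]
      refine ⟨⟨?_, ?_, ?_⟩, by ring⟩
      · exact mem_image_of_mem _ (by simp only [sphere, mem_filter, mem_box]; exact ⟨hx1, hx2⟩)
      · exact mem_image_of_mem _ (by simp only [sphere, mem_filter, mem_box]; exact ⟨hy1, hy2⟩)
      · simp only [setC, mem_image]
        refine ⟨p.1 + p.2, ?_, ?_⟩
        · simp only [sphere, mem_filter, mem_box, Pi.add_apply]
          refine ⟨fun j => by have := hx1 j; have := hy1 j; omega, ?_⟩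
          unfold nsq at hx2 hy2 ⊢
          simp only [Pi.add_apply]
          have hsq : ∀ j, (p.1 j + p.2 j) ^ 2 = p.1 j ^ 2 + 2 * (p.1 j * p.2 j) + p.2 j ^ 2 :=
            fun j => by ring
          simp only [hsq, sum_add_distrib, ← mul_sum]
          rw [hx2, hy2, hip]
          ring
        · rw [ev_add]; push_cast; ring
    exact hmem
  · intro p hp q hq hpq
    have hp' : p ∈ pairs d m r t := hp
    have hq' : q ∈ pairs d m r t := hq
    simp only [pairs, mem_filter, mem_product, sphere, mem_box] at hp' hq'
    simp only [Prod.mk.injEq] at hpq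
    obtain ⟨e1, e2, _⟩ := hpq
    have f1 : p.1 = q.1 := ev_inj M d _ _ (fun j => lt_of_lt_of_le (hp'.1.1.1 j) hmM')
      (fun j => lt_of_lt_of_le (hq'.1.1.1 j) hmM') (by exact_mod_cast e1)
    have f2 : p.2 = q.2 := ev_inj M d _ _ (fun j => lt_of_lt_of_le (hp'.1.2.1 j) hmM')
      (fun j => lt_of_lt_of_le (hq'.1.2.1 j) hmM') (by exact_mod_cast e2)
    exact Prod.ext f1 f2

/-- Pigeonhole 1: some sphere in `[0,m)^d` has at least `m^d / (d(m-1)²+1)` points. -/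
theorem exists_sphere : ∃ r ∈ range (d * (m - 1) ^ 2 + 1),
    m ^ d / (d * (m - 1) ^ 2 + 1) ≤ #(sphere d m r) := by
  have h := exists_le_card_fiber_of_mul_le_card_of_maps_to (s := box d m)
    (t := range (d * (m - 1) ^ 2 + 1)) (f := fun x => nsq x) (n := m ^ d / (d * (m - 1) ^ 2 + 1))
    (fun x hx => by rw [mem_range]; have := nsq_le (mem_box.1 hx); omega) ⟨0, by simp⟩
    (by rw [card_range, card_box]; exact Nat.mul_div_le _ _)
  obtain ⟨r, hr, h⟩ := h
  exact ⟨r, hr, h⟩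

/-- Pigeonhole 2: for some `t` at least `#S_r² / (d(m-1)²+1)` sphere pairs have inner product `t`. -/
theorem exists_pairs : ∃ t ∈ range (d * (m - 1) ^ 2 + 1),
    #(sphere d m r) ^ 2 / (d * (m - 1) ^ 2 + 1) ≤ #(pairs d m r t) := by
  have h := exists_le_card_fiber_of_mul_le_card_of_maps_to (s := sphere d m r ×ˢ sphere d m r)
    (t := range (d * (m - 1) ^ 2 + 1)) (f := fun p => ∑ j, p.1 j * p.2 j)
    (n := #(sphere d m r) ^ 2 / (d * (m - 1) ^ 2 + 1))
    (fun p hp => by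
      rw [mem_range]
      simp only [mem_product, sphere, mem_filter, mem_box] at hp
      have := ip_le hp.1.1 hp.2.1
      omega) ⟨0, by simp⟩
    (by rw [card_range, card_product, ← sq]; exact Nat.mul_div_le _ _)
  obtain ⟨t, ht, h⟩ := h
  exact ⟨t, ht, h⟩

/-- **Summary of the construction.**  For `1 ≤ m` and `2m ≤ M + 1` there are `r, t` such that
`(A, A, C)` is triforce-free for the target `2M^d` with at least `(m^d/K)^2/K` solutions, `K = d(m-1)²+1`. -/
theorem config_summary (hm : 1 ≤ m) (hmM : 2 * m ≤ M + 1) : ∃ r t : ℕ,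
    TriforceFree (setA d m M r) (setA d m M r) (setC d M r t) (tgt d M) ∧
    (m ^ d / (d * (m - 1) ^ 2 + 1)) ^ 2 / (d * (m - 1) ^ 2 + 1) ≤
      #(solutions (setA d m M r) (setA d m M r) (setC d M r t) (tgt d M)) := by
  obtain ⟨r, -, hr⟩ := exists_sphere d m
  obtain ⟨t, -, ht⟩ := exists_pairs d m r
  refine ⟨r, t, triforceFree_config d m M r t hmM, ?_⟩
  calc (m ^ d / (d * (m - 1) ^ 2 + 1)) ^ 2 / (d * (m - 1) ^ 2 + 1)
      ≤ #(sphere d m r) ^ 2 / (d * (m - 1) ^ 2 + 1) :=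
        Nat.div_le_div_right (Nat.pow_le_pow_left hr 2)
    _ ≤ #(pairs d m r t) := ht
    _ ≤ _ := card_pairs_le d m M r t hm hmM

end Config

/-- Arithmetic: the floor-division bound `(P/K)^2/K ≤ L` with `4K^3 ≤ P^2` gives `P^2 ≤ 4 K^3 L`. -/
theorem arith_bound {P K L : ℕ} (hK : 0 < K) (h : (P / K) ^ 2 / K ≤ L) (hbig : 4 * K ^ 3 ≤ P ^ 2) :
    P ^ 2 ≤ 4 * K ^ 3 * L := by
  set q := P / K with hq
  have h1 : P < (q + 1) * K := (Nat.div_lt_iff_lt_mul hK).1 (Nat.lt_succ_self _)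
  have h2 : q ^ 2 < (L + 1) * K := (Nat.div_lt_iff_lt_mul hK).1 (Nat.lt_succ_of_le h)
  have h3 : P ^ 2 < ((q + 1) * K) ^ 2 := Nat.pow_lt_pow_left h1 two_ne_zero
  have h4 : (q + 1) ^ 2 ≤ 2 * (q ^ 2 + 1) := by
    have : ((q : ℤ) + 1) ^ 2 ≤ 2 * ((q : ℤ) ^ 2 + 1) := by nlinarith [sq_nonneg ((q : ℤ) - 1)]
    exact_mod_cast this
  have h5 : q ^ 2 + 1 ≤ K * (L + 1) := by linarith
  have h6 : P ^ 2 < 2 * K ^ 3 * (L + 1) := by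
    calc P ^ 2 < ((q + 1) * K) ^ 2 := h3
      _ = K ^ 2 * (q + 1) ^ 2 := by ring
      _ ≤ K ^ 2 * (2 * (q ^ 2 + 1)) := Nat.mul_le_mul_left _ h4
      _ ≤ K ^ 2 * (2 * (K * (L + 1))) := Nat.mul_le_mul_left _ (Nat.mul_le_mul_left _ h5)
      _ = 2 * K ^ 3 * (L + 1) := by ring
  have hK3 : 0 < K ^ 3 := by positivity
  have hL : 2 ≤ L := by
    rcases Nat.lt_or_ge L 2 with hL | hL
    · interval_cases L <;> linarith
    · exact hL
  have h7 : K ^ 3 * 2 ≤ K ^ 3 * L := Nat.mul_le_mul_left _ hL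
  linarith

end Summit.MatrixMultiplication.MatrixMultiplication.Theorems.SoloVal
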